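import Literature.NumberTheory.LFunctions.TuranLiouvilleCriterion
import Literature.NumberTheory.LFunctions.LandauGeneralizedDirichlet
import Mathlib.NumberTheory.LSeries.Dirichlet

/-!
# `ConeMagnification`: the Landau transfer (route `SignCone`, item stmt-RiemannHypothesis-16303; HELPER file)

The 2001 magnification theorem (W-MAG, archive `rh-w-magnification/free/y1`, Thm 1.2) ends with an
"`M`-robust Landau transfer" (its Prop. 6.2): a nonnegative fake weight `c` with (continuation) `D_c(s) -
1/(s-1)`, `D_c(s) = Σ c(n) n^{-s}`, continuing analytically to thin rectangles about every horizontal segment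
`{σ + iγ : 1/2 < σ ≤ X}` (for slack-cone weights: the translate-boundedness / Bochner–Schwartz structure
theorem) and (deficit) `Σₙ (Λ(n) - c(n))₊ n^{-σ} < ∞` for all `σ > 1/2` (W-MAG Thm 1.2(i)) forces RH. This file
PROVES that transfer from the tree's Landau theorem for generalized Dirichlet series with nonnegative
coefficients (`Landau.summable_of_differentiableOn_union_convex`, Montgomery–Vaughan Thm 1.7):
`riemannHypothesis_of_fakeWeight_landau` — the series of `(c-Λ)₊ = c - Λ + (Λ-c)₊ ≥ 0` equals
`(D_c - 1/(s-1)) + ζ₁'/ζ₁ + Σ (Λ-c)₊ n^{-s}` on `Re s > x₁` (`LSeries_posPart_sub_vonMangoldt`; the poles at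
`s = 1` cancel through Mathlib's entire `ζ₁(s) = (s-1)ζ(s)`), which is holomorphic on `{Re s > x₁} ∪ W₀`,
`W₀` a thin rectangle about the real segment (`ζ₁` has no zero there, `TuranLiouville`), so by Landau it
converges absolutely for `Re s > 1/2`; at the height of a putative zero `ρ`, `1/2 < Re ρ < 1`, the same
identity exhibits `ζ₁' = Ψ ζ₁` with `Ψ` holomorphic on the connected set `{Re s > x₁} ∪ W_ρ ∋ ρ` (identity
theorem), whence `ζ₁ ≡ 0` near `ρ` (`eqOn_zero_of_deriv_eq_mul`) — absurd; so `QuasiRiemannHypothesis (1/2)`,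
i.e. RH. No route object enters; `SignConeConeMagnificationCompactness.lean` reduces the crux to ONE weight.
-/

noncomputable section

-- `Summit.RiemannHypothesis.RiemannHypothesis.…` repeats a namespace component by design (D-0017 layout).
set_option linter.dupNamespace false

open Complex Filter Set Metric Topology LSeries
open scoped ArithmeticFunction.vonMangoldt

namespace Summit.RiemannHypothesis.RiemannHypothesis.Theorems.SignCone

open Literature.NumberTheory.LFunctions

/-! ## `-ζ'/ζ = 1/(s-1) - ζ₁'/ζ₁` and the Dirichlet series of `(c - Λ)₊` -/

/-- For `Re s > 1`: `ζ₁(s) ≠ 0` and `-ζ'(s)/ζ(s) = 1/(s-1) - ζ₁'(s)/ζ₁(s)`, where `ζ₁(s) = (s-1)ζ(s)` is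
Mathlib's entire completion (`riemannZeta_eq_inv_sub_mul`, `deriv_riemannZeta_eq_neg_inv_sub_sq_mul_add`).
[folklore] -/
theorem neg_deriv_riemannZeta_div_eq {s : ℂ} (hs : 1 < s.re) :
    riemannZeta₁ s ≠ 0 ∧
      -deriv riemannZeta s / riemannZeta s = (s - 1)⁻¹ - logDeriv riemannZeta₁ s := by
  have hs1 : s ≠ 1 := by
    intro h; rw [h, one_re] at hs; exact lt_irrefl _ hs
  have hsub : s - 1 ≠ 0 := sub_ne_zero.2 hs1
  have hζ : riemannZeta s ≠ 0 := riemannZeta_ne_zero_of_one_lt_re hs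
  have hmul := riemannZeta_eq_inv_sub_mul hs1
  have hζ₁ : riemannZeta₁ s ≠ 0 := by
    intro h0; rw [h0, mul_zero] at hmul; exact hζ hmul
  refine ⟨hζ₁, ?_⟩
  rw [logDeriv_apply, deriv_riemannZeta_eq_neg_inv_sub_sq_mul_add hs1, hmul]
  field_simp
  ring

/-- `max (x, 0) = x + max (-x, 0)` in the form `(a - b)₊ = (a - b) + (b - a)₊`. [folklore] -/
theorem max_sub_zero_eq (a b : ℝ) : max (a - b) 0 = (a - b) + max (b - a) 0 := by
  rcases le_total a b with h | h
  · rw [max_eq_right (by linarith), max_eq_left (by linarith)]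
    ring
  · rw [max_eq_left (by linarith), max_eq_right (by linarith)]
    ring

/-- **The Dirichlet series of `(c - Λ)₊` on `Re s > 1`.** If `Σ c(n) n^{-s}` and `Σ (Λ-c)₊(n) n^{-s}`
converge absolutely at `s`, `Re s > 1`, then
`Σ (c-Λ)₊(n) n^{-s} = (Σ c(n) n^{-s} - 1/(s-1)) + ζ₁'(s)/ζ₁(s) + Σ (Λ-c)₊(n) n^{-s}`
(`(c-Λ)₊ = c - Λ + (Λ-c)₊`, `Σ Λ(n) n^{-s} = -ζ'/ζ(s)` and `neg_deriv_riemannZeta_div_eq`). [folklore] -/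
theorem LSeries_posPart_sub_vonMangoldt {c : ℕ → ℝ} {s : ℂ} (hs : 1 < s.re)
    (hcs : LSeriesSummable (fun n => (c n : ℂ)) s)
    (hds : LSeriesSummable (fun n => ((max (Λ n - c n) 0 : ℝ) : ℂ)) s) :
    LSeries (fun n => ((max (c n - Λ n) 0 : ℝ) : ℂ)) s =
      (LSeries (fun n => (c n : ℂ)) s - (s - 1)⁻¹) + logDeriv riemannZeta₁ s +
        LSeries (fun n => ((max (Λ n - c n) 0 : ℝ) : ℂ)) s := by
  have hΛs : LSeriesSummable (fun n => ((Λ n : ℝ) : ℂ)) s :=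
    ArithmeticFunction.LSeriesSummable_vonMangoldt hs
  have hfun : (fun n => ((max (c n - Λ n) 0 : ℝ) : ℂ)) =
      ((fun n => (c n : ℂ)) - fun n => ((Λ n : ℝ) : ℂ)) + fun n => ((max (Λ n - c n) 0 : ℝ) : ℂ) := by
    funext n
    simp only [Pi.add_apply, Pi.sub_apply]
    rw [max_sub_zero_eq (c n) (Λ n)]
    push_cast
    ring
  rw [hfun, LSeries_add (hcs.sub hΛs) hds, LSeries_sub hcs hΛs,
    ArithmeticFunction.LSeries_vonMangoldt_eq_deriv_riemannZeta_div hs]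
  rw [(neg_deriv_riemannZeta_div_eq hs).2]
  ring

/-! ## Uniqueness for `F' = Ψ F` on a ball -/

/-- A holomorphic solution of `F' = Ψ F` on a ball (`Ψ` holomorphic) with `F(ρ) = 0` at the centre
vanishes on the ball: with `P' = Ψ`, `P(ρ) = 0` (`DifferentiableOn.isExactOn_ball`) the function
`e^{-P} F` has zero derivative, so is constant `= F(ρ) = 0`. [folklore] -/
theorem eqOn_zero_of_deriv_eq_mul {Ψ F : ℂ → ℂ} {ρ : ℂ} {r : ℝ} (hr : 0 < r)
    (hΨ : DifferentiableOn ℂ Ψ (ball ρ r)) (hF : DifferentiableOn ℂ F (ball ρ r))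
    (hODE : ∀ z ∈ ball ρ r, deriv F z = Ψ z * F z) (h0 : F ρ = 0) :
    ∀ z ∈ ball ρ r, F z = 0 := by
  obtain ⟨P, hPρ, hP⟩ := hΨ.isExactOn_ball.with_val_at ρ 0
  set k : ℂ → ℂ := fun z ↦ exp (-P z) * F z with hk
  have hkd : ∀ z ∈ ball ρ r, HasDerivAt k 0 z := by
    intro z hz
    have h1 : HasDerivAt (fun w ↦ exp (-P w)) (exp (-P z) * -Ψ z) z := (hP z hz).neg.cexp
    have h2 : HasDerivAt F (deriv F z) z :=
      (hF.differentiableAt (isOpen_ball.mem_nhds hz)).hasDerivAt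
    have h3 := h1.mul h2
    have h4 : exp (-P z) * -Ψ z * F z + exp (-P z) * deriv F z = 0 := by
      rw [hODE z hz]
      ring
    rwa [h4] at h3
  have hkconst : ∀ z ∈ ball ρ r, k z = k ρ := fun z hz ↦
    isOpen_ball.is_const_of_deriv_eq_zero (convex_ball ρ r).isPreconnected
      (fun w hw ↦ (hkd w hw).differentiableAt.differentiableWithinAt)
      (fun w hw ↦ (hkd w hw).deriv) hz (mem_ball_self hr)
  intro z hz
  have h := hkconst z hz
  simp only [hk, h0, mul_zero, mul_eq_zero, Complex.exp_ne_zero, false_or] at h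
  exact h

/-! ## Gluing the series with a continuation on a rectangle -/

/-- Gluing a function `B` holomorphic on the half-plane `Re s > x₁` with a function `A` holomorphic on an
open set `W`, the two agreeing on the overlap: the glued function is holomorphic on the union, equals
`B` on the half-plane and `A` on `W`. [folklore] -/
theorem differentiableOn_glue {A B : ℂ → ℂ} {x₁ : ℝ} {W : Set ℂ} (hW : IsOpen W)
    (hB : DifferentiableOn ℂ B {s : ℂ | x₁ < s.re}) (hA : DifferentiableOn ℂ A W)
    (hagree : ∀ s ∈ W, x₁ < s.re → B s = A s) :
    DifferentiableOn ℂ (fun s => if x₁ < s.re then B s else A s) ({s : ℂ | x₁ < s.re} ∪ W) ∧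
      EqOn (fun s => if x₁ < s.re then B s else A s) B {s : ℂ | x₁ < s.re} ∧
      EqOn (fun s => if x₁ < s.re then B s else A s) A W := by
  set G : ℂ → ℂ := fun s => if x₁ < s.re then B s else A s with hG
  have hV : IsOpen {s : ℂ | x₁ < s.re} := isOpen_lt continuous_const continuous_re
  have hGB : EqOn G B {s : ℂ | x₁ < s.re} := fun s hs => by
    simp only [hG, if_pos (show x₁ < s.re from hs)]
  have hGA : EqOn G A W := fun s hs => by
    by_cases h : x₁ < s.re
    · simp only [hG, if_pos h]
      exact hagree s hs h
    · simp only [hG, if_neg h]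
  refine ⟨?_, hGB, hGA⟩
  rintro s (hs | hs)
  · have hev : G =ᶠ[𝓝 s] B := eventuallyEq_of_mem (hV.mem_nhds hs) hGB
    exact ((hB.differentiableAt (hV.mem_nhds hs)).congr_of_eventuallyEq hev).differentiableWithinAt
  · have hev : G =ᶠ[𝓝 s] A := eventuallyEq_of_mem (hW.mem_nhds hs) hGA
    exact ((hA.differentiableAt (hW.mem_nhds hs)).congr_of_eventuallyEq hev).differentiableWithinAt

/-- The thin open rectangle `(1/2, X) × (γ - δ, γ + δ)` is open and convex. [folklore] -/
theorem isOpen_convex_rect (X γ δ : ℝ) :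
    IsOpen (({s : ℂ | 1 / 2 < s.re} ∩ {s : ℂ | s.re < X}) ∩ ({s : ℂ | s.im < γ + δ} ∩ {s : ℂ | γ - δ < s.im})) ∧
      Convex ℝ (({s : ℂ | 1 / 2 < s.re} ∩ {s : ℂ | s.re < X}) ∩
        ({s : ℂ | s.im < γ + δ} ∩ {s : ℂ | γ - δ < s.im})) :=
  ⟨((isOpen_lt continuous_const continuous_re).inter (isOpen_lt continuous_re continuous_const)).inter
      ((isOpen_lt continuous_im continuous_const).inter (isOpen_lt continuous_const continuous_im)),
    ((convex_halfSpace_re_gt _).inter (convex_halfSpace_re_lt _)).inter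
      ((convex_halfSpace_im_lt _).inter (convex_halfSpace_im_gt _))⟩

/-! ## The transfer -/

/-- **The Landau transfer of the magnification theorem** (archive 2001 W-MAG, Prop. 6.2 / Thm 1.2(ii),
with the continuation of `D_c` as an explicit hypothesis). Let `c ≥ 0` be a weight on `ℕ` whose
Dirichlet series `D_c(s) = Σ c(n) n^{-s}` converges absolutely at some real `x₀` and such that

* (continuation) for every height `γ` and every `X`, `D_c(s) - 1/(s-1)` agrees, on the part of a thin open
  rectangle `(1/2, X) × (γ - δ, γ + δ)` where `Re s > x₀`, with a function holomorphic on the whole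
  rectangle;
* (deficit) `Σₙ (Λ(n) - c(n))₊ n^{-σ} < ∞` for every real `σ > 1/2`.

Then the Riemann hypothesis holds. Proof: the Dirichlet series of `(c - Λ)₊ = c - Λ + (Λ - c)₊ ≥ 0`
equals `(D_c - 1/(s-1)) + ζ₁'/ζ₁ + Σ (Λ-c)₊ n^{-s}` on `Re s > x₁` (`LSeries_posPart_sub_vonMangoldt`), which
is holomorphic on `{Re s > x₁} ∪ W₀`, `W₀` a thin rectangle about the real segment `(1/2, x₁ + 2)` (no real
zeros of `ζ₁`, `TuranLiouville.exists_strip_riemannZeta₁_ne_zero`); Landau's theorem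
(`Landau.summable_of_differentiableOn_union_convex`) gives absolute convergence for `Re s > 1/2`; for a
zero `ρ` of `ζ` with `1/2 < Re ρ < 1` the same identity at height `Im ρ` exhibits `ζ₁' = Ψ ζ₁` near `ρ` with
`Ψ` holomorphic (identity theorem on `{Re s > x₁} ∪ W_ρ`), whence `ζ₁ ≡ 0` near `ρ`
(`eqOn_zero_of_deriv_eq_mul`), contradicting `ζ₁(1) = 1`; so `QuasiRiemannHypothesis (1/2)`, which is RH
(`quasiRiemannHypothesis_one_half_iff_holds`). [folklore] -/
theorem riemannHypothesis_of_fakeWeight_landau {c : ℕ → ℝ} (hc : ∀ n, 0 ≤ c n) {x₀ : ℝ}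
    (hsum : LSeriesSummable (fun n => (c n : ℂ)) x₀)
    (hcont : ∀ γ X : ℝ, ∃ δ : ℝ, 0 < δ ∧ ∃ A : ℂ → ℂ,
      DifferentiableOn ℂ A (({s : ℂ | 1 / 2 < s.re} ∩ {s : ℂ | s.re < X}) ∩
        ({s : ℂ | s.im < γ + δ} ∩ {s : ℂ | γ - δ < s.im})) ∧
      ∀ s ∈ (({s : ℂ | 1 / 2 < s.re} ∩ {s : ℂ | s.re < X}) ∩
        ({s : ℂ | s.im < γ + δ} ∩ {s : ℂ | γ - δ < s.im})), x₀ < s.re → s ≠ 1 →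
        LSeries (fun n => (c n : ℂ)) s = A s + (s - 1)⁻¹)
    (hdef : ∀ σ : ℝ, 1 / 2 < σ → LSeriesSummable (fun n => ((max (Λ n - c n) 0 : ℝ) : ℂ)) σ) :
    RiemannHypothesis := by
  -- notation: `f = (c - Λ)₊`, `d = (Λ - c)₊`, the abscissa `x₁`
  set f : ℕ → ℝ := fun n => max (c n - Λ n) 0 with hf
  set d : ℕ → ℝ := fun n => max (Λ n - c n) 0 with hd
  set x₁ : ℝ := max x₀ 2 with hx₁
  have hx₀₁ : x₀ ≤ x₁ := le_max_left _ _
  have h2x₁ : (2 : ℝ) ≤ x₁ := le_max_right _ _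
  set V : Set ℂ := {s : ℂ | x₁ < s.re} with hV
  have hVo : IsOpen V := isOpen_lt continuous_const continuous_re
  -- summability and analyticity of the three Dirichlet series
  have hcs : ∀ s : ℂ, x₀ < s.re → LSeriesSummable (fun n => (c n : ℂ)) s := fun s hs =>
    hsum.of_re_le_re (by rw [ofReal_re]; exact hs.le)
  have hds : ∀ s : ℂ, 1 / 2 < s.re → LSeriesSummable (fun n => ((d n : ℝ) : ℂ)) s := fun s hs => by
    obtain ⟨σ, hσ, hσs⟩ : ∃ σ : ℝ, 1 / 2 < σ ∧ σ ≤ s.re := ⟨s.re, hs, le_rfl⟩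
    exact (hdef σ hσ).of_re_le_re (by rw [ofReal_re]; exact hσs)
  have habsc : abscissaOfAbsConv (fun n => (c n : ℂ)) ≤ x₀ := by
    have := hsum.abscissaOfAbsConv_le
    rwa [ofReal_re] at this
  have habsd : abscissaOfAbsConv (fun n => ((d n : ℝ) : ℂ)) ≤ (1 / 2 : ℝ) :=
    abscissaOfAbsConv_le_of_forall_lt_LSeriesSummable fun y hy => hds y (by rw [ofReal_re]; exact hy)
  have hBc : DifferentiableOn ℂ (fun s => LSeries (fun n => (c n : ℂ)) s - (s - 1)⁻¹) V := by
    intro s hs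
    have hs' : x₁ < s.re := hs
    have hsa : abscissaOfAbsConv (fun n => (c n : ℂ)) < s.re :=
      habsc.trans_lt (by exact_mod_cast (hx₀₁.trans_lt hs'))
    have hs1 : s - 1 ≠ 0 := by
      rw [sub_ne_zero]
      intro h
      rw [h, one_re] at hs'
      linarith
    exact ((LSeries_analyticOnNhd _ s hsa).differentiableAt.sub
      ((differentiableAt_id.sub_const 1).inv hs1)).differentiableWithinAt
  have hDd : DifferentiableOn ℂ (LSeries fun n => ((d n : ℝ) : ℂ)) {s : ℂ | 1 / 2 < s.re} := by
    intro s hs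
    have hs' : 1 / 2 < s.re := hs
    have hsa : abscissaOfAbsConv (fun n => ((d n : ℝ) : ℂ)) < s.re :=
      habsd.trans_lt (by exact_mod_cast hs')
    exact (LSeries_analyticOnNhd _ s hsa).differentiableAt.differentiableWithinAt
  -- `ζ₁ ≠ 0` on `Re s > 1` and on a thin strip about the real segment `[1/2, 5]`
  obtain ⟨δ₁, hδ₁, hfree⟩ := TuranLiouville.exists_strip_riemannZeta₁_ne_zero
  have hζ₁V : ∀ s : ℂ, 1 < s.re → riemannZeta₁ s ≠ 0 := fun s hs => (neg_deriv_riemannZeta_div_eq hs).1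
  have hζ₁d : ∀ s : ℂ, riemannZeta₁ s ≠ 0 → DifferentiableAt ℂ (logDeriv riemannZeta₁) s := by
    intro s hs
    have h : logDeriv riemannZeta₁ = fun z ↦ deriv riemannZeta₁ z / riemannZeta₁ z := by
      funext z; rw [logDeriv_apply]
    rw [h]
    exact (differentiable_riemannZeta₁.analyticAt s).deriv.differentiableAt.div
      (differentiable_riemannZeta₁ s) hs
  -- the identity `LSeries f = (D_c - 1/(s-1)) + ζ₁'/ζ₁ + LSeries d` on `V`
  have hident : ∀ s ∈ V, LSeries (fun n => ((f n : ℝ) : ℂ)) s =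
      (LSeries (fun n => (c n : ℂ)) s - (s - 1)⁻¹) + logDeriv riemannZeta₁ s +
        LSeries (fun n => ((d n : ℝ) : ℂ)) s := by
    intro s hs
    have hs' : x₁ < s.re := hs
    have h1 : 1 < s.re := by linarith
    exact LSeries_posPart_sub_vonMangoldt h1 (hcs s (by linarith)) (hds s (by linarith))
  -- the generalized-Dirichlet data of `f`
  set a : ℕ → ℝ := fun n => if n = 0 then 0 else f n with ha
  set ℓ : ℕ → ℝ := fun n => Real.log n with hℓ
  have ha0 : ∀ n, 0 ≤ a n := fun n => by
    simp only [ha]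
    split_ifs
    · exact le_rfl
    · exact le_max_right _ _
  have hℓ0 : ∀ n, 0 ≤ ℓ n := fun n => Real.log_natCast_nonneg n
  have hLf : ∀ s : ℂ, LSeries (fun n => ((f n : ℝ) : ℂ)) s = Landau.genDirichlet a ℓ s := fun s =>
    Landau.LSeries_eq_genDirichlet f s
  have hSf : ∀ σ : ℝ, LSeriesSummable (fun n => ((f n : ℝ) : ℂ)) σ ↔
      Summable fun n : ℕ => a n * Real.exp (-(ℓ n * σ)) := fun σ =>
    Landau.LSeriesSummable_ofReal_iff f σ
  -- `LSeries f` converges absolutely at `x₁` (comparison `0 ≤ f ≤ c`)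
  have hfx₁ : LSeriesSummable (fun n => ((f n : ℝ) : ℂ)) x₁ := by
    have hcx₁ : LSeriesSummable (fun n => (c n : ℂ)) x₁ := hsum.of_re_le_re (by simpa using hx₀₁)
    refine Summable.of_norm_bounded hcx₁.norm fun n => norm_term_le _ ?_
    rw [Complex.norm_real, Complex.norm_real, Real.norm_of_nonneg (le_max_right _ _),
      Real.norm_of_nonneg (hc n)]
    exact max_le (by linarith [ArithmeticFunction.vonMangoldt_nonneg (n := n)]) (hc n)
  have h₁ : Summable fun n : ℕ => a n * Real.exp (-(ℓ n * x₁)) := (hSf x₁).1 hfx₁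
  -- STEP 1: Landau along the real axis, `W₀` a thin rectangle about `(1/2, x₁ + 2)`
  obtain ⟨δ₀, hδ₀, A₀, hA₀, hA₀eq⟩ := hcont 0 (x₁ + 2)
  set δ : ℝ := min δ₀ δ₁ with hδ
  have hδp : 0 < δ := lt_min hδ₀ hδ₁
  set W₀ : Set ℂ := ({s : ℂ | 1 / 2 < s.re} ∩ {s : ℂ | s.re < x₁ + 2}) ∩
    ({s : ℂ | s.im < 0 + δ} ∩ {s : ℂ | 0 - δ < s.im}) with hW₀
  have hW₀oc := isOpen_convex_rect (x₁ + 2) 0 δ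
  have hW₀sub : W₀ ⊆ ({s : ℂ | 1 / 2 < s.re} ∩ {s : ℂ | s.re < x₁ + 2}) ∩
      ({s : ℂ | s.im < 0 + δ₀} ∩ {s : ℂ | 0 - δ₀ < s.im}) := by
    rintro s ⟨⟨h1, h2⟩, h3, h4⟩
    have h3' : s.im < 0 + δ := h3
    have h4' : 0 - δ < s.im := h4
    refine ⟨⟨h1, h2⟩, ?_, ?_⟩
    · show s.im < 0 + δ₀; linarith [min_le_left δ₀ δ₁]
    · show 0 - δ₀ < s.im; linarith [min_le_left δ₀ δ₁]
  have hW₀r : ∀ σ : ℝ, 1 / 2 < σ → σ ≤ x₁ + 1 → (σ : ℂ) ∈ W₀ := fun σ h1 h2 => by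
    refine ⟨⟨?_, ?_⟩, ?_, ?_⟩ <;> simp only [mem_setOf_eq, ofReal_re, ofReal_im] <;> linarith
  have hζ₁W₀ : ∀ s ∈ W₀, riemannZeta₁ s ≠ 0 := by
    rintro s ⟨⟨h1, h2⟩, h3, h4⟩
    have h1' : 1 / 2 < s.re := h1
    have h3' : s.im < 0 + δ := h3
    have h4' : 0 - δ < s.im := h4
    rcases le_or_gt s.re 5 with h5 | h5
    · exact hfree s h1'.le h5 (abs_lt.2 ⟨by linarith [min_le_right δ₀ δ₁], by linarith [min_le_right δ₀ δ₁]⟩)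
    · exact hζ₁V s (by linarith)
  obtain ⟨hG₀d, hG₀B, hG₀A⟩ := differentiableOn_glue (x₁ := x₁) hW₀oc.1 hBc (hA₀.mono hW₀sub)
    (fun s hs hsx => by
      have hs1 : s ≠ 1 := by
        intro h; have := congrArg Complex.re h; rw [one_re] at this; linarith
      have := hA₀eq s (hW₀sub hs) (by linarith) hs1
      rw [this]; ring)
  set Φ₀ : ℂ → ℂ := fun s => (if x₁ < s.re then LSeries (fun n => (c n : ℂ)) s - (s - 1)⁻¹ else A₀ s) +
    logDeriv riemannZeta₁ s + LSeries (fun n => ((d n : ℝ) : ℂ)) s with hΦ₀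
  have hΦ₀d : DifferentiableOn ℂ Φ₀ (V ∪ W₀) := by
    refine (hG₀d.add fun s hs => (hζ₁d s ?_).differentiableWithinAt).add (hDd.mono ?_)
    · rcases hs with hs | hs
      · exact hζ₁V s (by have : x₁ < s.re := hs; linarith)
      · exact hζ₁W₀ s hs
    · rintro s (hs | ⟨⟨hs, _⟩, _⟩)
      · show 1 / 2 < s.re
        have : x₁ < s.re := hs
        linarith
      · exact hs
  have hagree₀ : EqOn Φ₀ (Landau.genDirichlet a ℓ) V := by
    intro s hs
    rw [← hLf s, hident s hs]
    simp only [hΦ₀, hG₀B hs]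
  have hall : ∀ σ : ℝ, 1 / 2 < σ → LSeriesSummable (fun n => ((f n : ℝ) : ℂ)) σ := fun σ hσ =>
    (hSf σ).2 (Landau.summable_of_differentiableOn_union_convex ha0 hℓ0 h₁
      (by linarith : (1 / 2 : ℝ) < x₁) hW₀oc.1 hW₀oc.2 hW₀r hΦ₀d hagree₀ hσ)
  -- STEP 2: `LSeries f` is holomorphic on `Re s > 1/2`
  have habsf : abscissaOfAbsConv (fun n => ((f n : ℝ) : ℂ)) ≤ (1 / 2 : ℝ) :=
    abscissaOfAbsConv_le_of_forall_lt_LSeriesSummable fun y hy => hall y (by exact_mod_cast hy)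
  have hDf : DifferentiableOn ℂ (LSeries fun n => ((f n : ℝ) : ℂ)) {s : ℂ | 1 / 2 < s.re} := by
    intro s hs
    have hs' : 1 / 2 < s.re := hs
    have hsa : abscissaOfAbsConv (fun n => ((f n : ℝ) : ℂ)) < s.re :=
      habsf.trans_lt (by exact_mod_cast hs')
    exact (LSeries_analyticOnNhd _ s hsa).differentiableAt.differentiableWithinAt
  -- STEP 3: no zero of `ζ` with `1/2 < Re ρ < 1`
  refine quasiRiemannHypothesis_one_half_iff_holds.1 fun ρ hζρ hρ₁ hρ₂ => ?_
  have hρne : ρ ≠ 1 := by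
    intro h; rw [h, one_re] at hρ₂; linarith
  have hζ₁ρ : riemannZeta₁ ρ = 0 := by
    have h := riemannZeta_eq_inv_sub_mul hρne
    rw [hζρ] at h
    rcases mul_eq_zero.1 h.symm with h0 | h0
    · exact absurd h0 (inv_ne_zero (sub_ne_zero.2 hρne))
    · exact h0
  obtain ⟨δ₂, hδ₂, A₂, hA₂, hA₂eq⟩ := hcont ρ.im (x₁ + 2)
  set W₂ : Set ℂ := ({s : ℂ | 1 / 2 < s.re} ∩ {s : ℂ | s.re < x₁ + 2}) ∩
    ({s : ℂ | s.im < ρ.im + δ₂} ∩ {s : ℂ | ρ.im - δ₂ < s.im}) with hW₂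
  have hW₂oc := isOpen_convex_rect (x₁ + 2) ρ.im δ₂
  have hρW₂ : ρ ∈ W₂ := by
    refine ⟨⟨hρ₁, ?_⟩, ?_, ?_⟩ <;> simp only [mem_setOf_eq] <;> linarith
  obtain ⟨hG₂d, hG₂B, hG₂A⟩ := differentiableOn_glue (x₁ := x₁) hW₂oc.1 hBc hA₂
    (fun s hs hsx => by
      have hs1 : s ≠ 1 := by
        intro h; have := congrArg Complex.re h; rw [one_re] at this; linarith
      have := hA₂eq s hs (by linarith) hs1
      rw [this]; ring)
  set Ψ : ℂ → ℂ := fun s => LSeries (fun n => ((f n : ℝ) : ℂ)) s - LSeries (fun n => ((d n : ℝ) : ℂ)) s -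
    (if x₁ < s.re then LSeries (fun n => (c n : ℂ)) s - (s - 1)⁻¹ else A₂ s) with hΨ
  have hsubH : V ∪ W₂ ⊆ {s : ℂ | 1 / 2 < s.re} := by
    rintro s (hs | ⟨⟨hs, _⟩, _⟩)
    · show 1 / 2 < s.re
      have : x₁ < s.re := hs
      linarith
    · exact hs
  have hΨd : DifferentiableOn ℂ Ψ (V ∪ W₂) :=
    ((hDf.mono hsubH).sub (hDd.mono hsubH)).sub hG₂d
  have hUo : IsOpen (V ∪ W₂) := hVo.union hW₂oc.1
  -- `ζ₁' = Ψ ζ₁` on `V`, hence on `V ∪ W₂` by the identity theorem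
  have hODE_V : ∀ s ∈ V, deriv riemannZeta₁ s = Ψ s * riemannZeta₁ s := by
    intro s hs
    have hs' : x₁ < s.re := hs
    have hne := hζ₁V s (by linarith)
    have hΨs : Ψ s = logDeriv riemannZeta₁ s := by
      simp only [hΨ, hG₂B hs]
      rw [hident s hs]
      ring
    rw [hΨs, logDeriv_apply, div_mul_cancel₀ _ hne]
  have hL : AnalyticOnNhd ℂ (deriv riemannZeta₁) (V ∪ W₂) := fun s _ =>
    (differentiable_riemannZeta₁.analyticAt s).deriv
  have hR : AnalyticOnNhd ℂ (fun s => Ψ s * riemannZeta₁ s) (V ∪ W₂) :=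
    (hΨd.mul fun s _ => (differentiable_riemannZeta₁ s).differentiableWithinAt).analyticOnNhd hUo
  set p : ℂ := ((x₁ + 1 : ℝ) : ℂ) + ρ.im * I with hp
  have hpV : p ∈ V := by
    show x₁ < p.re
    simp [hp]
  have hpW₂ : p ∈ W₂ := by
    refine ⟨⟨?_, ?_⟩, ?_, ?_⟩ <;> simp [hp] <;> linarith
  have hpre : IsPreconnected (V ∪ W₂) :=
    IsPreconnected.union p hpV hpW₂ (convex_halfSpace_re_gt x₁).isPreconnected hW₂oc.2.isPreconnected
  have hev : deriv riemannZeta₁ =ᶠ[𝓝 p] fun s => Ψ s * riemannZeta₁ s :=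
    eventuallyEq_of_mem (hVo.mem_nhds hpV) hODE_V
  have hODE : EqOn (deriv riemannZeta₁) (fun s => Ψ s * riemannZeta₁ s) (V ∪ W₂) :=
    hL.eqOn_of_preconnected_of_eventuallyEq hR hpre (Or.inl hpV) hev
  -- a ball about `ρ` inside `W₂`, where `ζ₁` must then vanish identically
  obtain ⟨r, hr, hball⟩ := Metric.isOpen_iff.1 hW₂oc.1 ρ hρW₂
  have hzero : ∀ z ∈ ball ρ r, riemannZeta₁ z = 0 :=
    eqOn_zero_of_deriv_eq_mul hr (hΨd.mono fun z hz => Or.inr (hball hz))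
      (differentiable_riemannZeta₁.differentiableOn) (fun z hz => hODE (Or.inr (hball hz))) hζ₁ρ
  have hev0 : riemannZeta₁ =ᶠ[𝓝 ρ] 0 :=
    eventuallyEq_of_mem (isOpen_ball.mem_nhds (mem_ball_self hr)) fun z hz => hzero z hz
  have hall0 : EqOn riemannZeta₁ 0 univ :=
    (differentiable_riemannZeta₁.differentiableOn.analyticOnNhd isOpen_univ).eqOn_zero_of_preconnected_of_eventuallyEq_zero
      isPreconnected_univ (mem_univ ρ) hev0
  have h1 := hall0 (mem_univ (1 : ℂ))
  rw [riemannZeta₁_one] at h1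
  exact one_ne_zero h1

end Summit.RiemannHypothesis.RiemannHypothesis.Theorems.SignCone

end
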